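import Summits.Ventures.PercRepro.C026GluingMinor
import Summits.Ventures.PercRepro.C026GluingTransport

/-!
# The composition theorem at every `p`: faces of a gluing are gluings of faces (p6, gen 8)

mine-3 §26.8: «if both parts range over face-closed (★)-families then C-026 holds at every `p` on
the glued family (its faces are gluings of faces)».  With `C026GluingMinor` (a marked minor of a
gluing is a gluing, `c026_of_gluing_minors`) what remains is to compare the PART of colour `s` of a
marked minor `G.minor u v` with the marked MINOR of the part `(G.part side s).minor u_s v_s`
(`u_s`, `v_s` the restrictions): the edges agree (`faceEquiv`), and the part's sure classes map to the
gluing's sure classes (`classMap`) injectively on the support and the marks — a sure path of `G`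
between two vertices carrying colour `s` (or marks) stays in the part of colour `s` unless it joins
two distinct marks (`conn_part_of_conn_of_markOrCol`).  `C026GluingTransport.dFreeIneq_map` then
transports the D-free inequality, and

* **`c026_of_gluing_of_dFree_minors`**: for a gluing `G`, the D-free inequality on every marked minor
  of each part (with the part's own sure classes as marks) gives C-026 at every `p` on `G` — the
  every-`p` composition theorem.
-/

namespace PercRepro

namespace MultiGraph

section EveryP

variable {V E : Type*} {G : MultiGraph V E} {a b c : V} {side : E → Bool}

/-- `x` is a mark or carries an edge of colour `s`. -/
def MarkOrCol (G : MultiGraph V E) (a b c : V) (side : E → Bool) (s : Bool) (x : V) : Prop :=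
  (x = a ∨ x = b ∨ x = c) ∨ G.HasCol side s x

/-- **A sure path between two vertices carrying colour `s` (or marks) stays in the part of colour
`s`**, provided no two distinct marks are sure-joined.  Invariant along the path from `x`: a
one-coloured walk of colour `s` from `x` to a pivot (`x` itself or a mark), then a one-coloured walk
of some colour from the pivot. -/
theorem conn_part_of_conn_of_markOrCol (hg : G.IsGluing a b c side) {σ : Config E}
    (hnd : ∀ m m', (m = a ∨ m = b ∨ m = c) → (m' = a ∨ m' = b ∨ m' = c) → m ≠ m' →
      ¬ G.Conn σ m m') {s : Bool} {x y : V} (hx : G.MarkOrCol a b c side s x)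
    (hy : G.MarkOrCol a b c side s y) (hxy : G.Conn σ x y) :
    (G.part side s).Conn (sideRestrict σ side s) x y := by
  -- a non-mark carrying colour `s` carries no other colour
  have hcol : ∀ {z : V}, G.MarkOrCol a b c side s z → ¬ (z = a ∨ z = b ∨ z = c) →
      ∀ {s' : Bool}, G.HasCol side s' z → s' = s := by
    intro z hz hzm s' hz'
    rcases hz with hz | hz
    · exact absurd hz hzm
    · push Not at hzm
      exact hg.eq_of_hasCol hzm.1 hzm.2.1 hzm.2.2 hz' hz
  suffices key : ∃ m, (m = x ∨ (m = a ∨ m = b ∨ m = c)) ∧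
      (G.part side s).Conn (sideRestrict σ side s) x m ∧
      ∃ s', (G.part side s').Conn (sideRestrict σ side s') m y by
    obtain ⟨m, hm, hxm, s', hmy⟩ := key
    by_cases hym : y = m
    · subst hym
      exact hxm
    have hcy : G.HasCol side s' y := hasCol_of_conn_part hmy hym
    by_cases hymk : y = a ∨ y = b ∨ y = c
    · -- `y` is a mark: the pivot must be `x`, a non-mark of colour `s`
      rcases hm with rfl | hm
      · rcases hx with hxk | hxk
        · exact absurd (Conn.of_part hmy) (hnd _ _ hxk hymk (Ne.symm hym))
        · have hxm' : ¬ (m = a ∨ m = b ∨ m = c) := by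
            rintro hmk
            exact hnd _ _ hmk hymk (Ne.symm hym) (Conn.of_part hmy)
          have : s' = s := hcol (Or.inr hxk) hxm' (hasCol_of_conn_part hmy.symm (Ne.symm hym))
          subst this
          exact hmy
      · exact absurd (Conn.of_part hmy) (hnd _ _ hm hymk (Ne.symm hym))
    · have : s' = s := hcol hy hymk hcy
      subst this
      exact hxm.trans hmy
  refine Conn.induction (motive := fun z => ∃ m, (m = x ∨ (m = a ∨ m = b ∨ m = c)) ∧
      (G.part side s).Conn (sideRestrict σ side s) x m ∧
      ∃ s', (G.part side s').Conn (sideRestrict σ side s') m z)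
    ⟨x, Or.inl rfl, Conn.refl _ _ _, true, Conn.refl _ _ _⟩ ?_ hxy
  intro z z' _ hzz' hz
  obtain ⟨m, hm, hxm, s', hmz⟩ := hz
  obtain ⟨f, hf, hend⟩ := hzz'
  have hj : G.Joins f z z' := hend
  by_cases hzm : z = m
  · -- restart the second walk at the pivot, in the colour of `f`
    subst hzm
    exact ⟨z, hm, hxm, side f, Conn.of_openAdj (openAdj_part_of_open hf hj)⟩
  have hcz : G.HasCol side s' z := hasCol_of_conn_part hmz hzm
  by_cases hzk : z = a ∨ z = b ∨ z = c
  · -- `z` is a mark: then the pivot is `x`, a non-mark of colour `s`, and `z` becomes the pivot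
    rcases hm with rfl | hm
    · rcases hx with hxk | hxk
      · exact absurd (Conn.of_part hmz) (hnd _ _ hxk hzk (Ne.symm hzm))
      · have hmk : ¬ (m = a ∨ m = b ∨ m = c) := by
          rintro hmk
          exact hnd _ _ hmk hzk (Ne.symm hzm) (Conn.of_part hmz)
        have : s' = s := hcol (Or.inr hxk) hmk (hasCol_of_conn_part hmz.symm (Ne.symm hzm))
        subst this
        exact ⟨z, Or.inr hzk, hmz, side f, Conn.of_openAdj (openAdj_part_of_open hf hj)⟩
    · exact absurd (Conn.of_part hmz) (hnd _ _ hm hzk (Ne.symm hzm))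
  · -- `z` is a non-mark of colour `s'`: the edge `f` has colour `s'`
    push Not at hzk
    have hf' : side f = s' :=
      hg.eq_of_hasCol hzk.1 hzk.2.1 hzk.2.2 (HasCol.of_joins (side := side) hj).1 hcz
    refine ⟨m, hm, hxm, s', hmz.tail ?_⟩
    have := openAdj_part_of_open (side := side) hf hj
    rw [hf'] at this
    exact this

/-- The free edges of colour `s` of the class `(u, v)` are the free edges of the part's class. -/
def faceEquiv (side : E → Bool) (s : Bool) (u v : Config E) :
    Face (sideRestrict u side s) (sideRestrict v side s) ≃ {e : Face u v // side e.1 = s} where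
  toFun e := ⟨⟨e.1.1, e.2⟩, e.1.2⟩
  invFun e := ⟨⟨e.1.1, e.2⟩, e.1.2⟩
  left_inv _ := rfl
  right_inv _ := rfl

/-- The sure classes of the part map to the sure classes of `G`. -/
def classMap (G : MultiGraph V E) (side : E → Bool) (s : Bool) (v : Config E) :
    Quotient ((G.part side s).connSetoid (sideRestrict v side s)) → Quotient (G.connSetoid v) :=
  Quotient.lift (fun x => G.sureClass v x)
    (fun _ _ h => (G.sureClass_eq_iff v _ _).mpr (Conn.of_part h))

/-- `classMap` on a class. -/
@[simp] theorem classMap_mk (side : E → Bool) (s : Bool) (v : Config E) (x : V) :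
    G.classMap side s v ((G.part side s).sureClass (sideRestrict v side s) x) =
      G.sureClass v x := rfl

/-- A vertex of the support of the part's minor (or a mark) is sure-joined in the part to a vertex
that is a mark or carries colour `s`. -/
theorem exists_markOrCol_of_supp (side : E → Bool) (s : Bool) (u v : Config E) {x : V}
    (h : ((G.part side s).minor (sideRestrict u side s) (sideRestrict v side s)).Supp
      ((G.part side s).sureClass (sideRestrict v side s) a)
      ((G.part side s).sureClass (sideRestrict v side s) b)
      ((G.part side s).sureClass (sideRestrict v side s) c)
      ((G.part side s).sureClass (sideRestrict v side s) x)) :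
    ∃ x', (G.part side s).Conn (sideRestrict v side s) x' x ∧ G.MarkOrCol a b c side s x' := by
  rcases h with ⟨e, he⟩ | h | h | h
  · -- an endpoint of the free edge `e.1.1` of colour `s`
    rcases he with he | he
    · refine ⟨G.fst e.1.1, ((G.part side s).sureClass_eq_iff _ _ _).mp he, Or.inr ?_⟩
      exact ⟨e.1.1, e.1.2, Or.inl rfl⟩
    · refine ⟨G.snd e.1.1, ((G.part side s).sureClass_eq_iff _ _ _).mp he, Or.inr ?_⟩
      exact ⟨e.1.1, e.1.2, Or.inr rfl⟩
  · exact ⟨a, (((G.part side s).sureClass_eq_iff _ _ _).mp h).symm, Or.inl (Or.inl rfl)⟩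
  · exact ⟨b, (((G.part side s).sureClass_eq_iff _ _ _).mp h).symm, Or.inl (Or.inr (Or.inl rfl))⟩
  · exact ⟨c, (((G.part side s).sureClass_eq_iff _ _ _).mp h).symm, Or.inl (Or.inr (Or.inr rfl))⟩

/-- **`classMap` is injective on the support and the marks** when no two distinct marks are
sure-joined in `G`. -/
theorem classMap_injOn (hg : G.IsGluing a b c side) (s : Bool) (u v : Config E)
    (hnd : ∀ m m', (m = a ∨ m = b ∨ m = c) → (m' = a ∨ m' = b ∨ m' = c) → m ≠ m' →
      ¬ G.Conn v m m') (q q' : Quotient ((G.part side s).connSetoid (sideRestrict v side s)))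
    (hq : ((G.part side s).minor (sideRestrict u side s) (sideRestrict v side s)).Supp
      ((G.part side s).sureClass (sideRestrict v side s) a)
      ((G.part side s).sureClass (sideRestrict v side s) b)
      ((G.part side s).sureClass (sideRestrict v side s) c) q)
    (hq' : ((G.part side s).minor (sideRestrict u side s) (sideRestrict v side s)).Supp
      ((G.part side s).sureClass (sideRestrict v side s) a)
      ((G.part side s).sureClass (sideRestrict v side s) b)
      ((G.part side s).sureClass (sideRestrict v side s) c) q')
    (h : G.classMap side s v q = G.classMap side s v q') : q = q' := by
  obtain ⟨x, rfl⟩ := Quotient.exists_rep q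
  obtain ⟨y, rfl⟩ := Quotient.exists_rep q'
  obtain ⟨x', hx'x, hx'⟩ := exists_markOrCol_of_supp (a := a) (b := b) (c := c) side s u v hq
  obtain ⟨y', hy'y, hy'⟩ := exists_markOrCol_of_supp (a := a) (b := b) (c := c) side s u v hq'
  have hxy : G.Conn v x y := (G.sureClass_eq_iff v x y).mp h
  have hx'y' : G.Conn v x' y' :=
    ((Conn.of_part hx'x).trans hxy).trans (Conn.of_part hy'y).symm
  have key := conn_part_of_conn_of_markOrCol hg hnd hx' hy' hx'y'
  exact ((G.part side s).sureClass_eq_iff _ _ _).mpr (hx'x.symm.trans (key.trans hy'y))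

variable [Fintype E] [DecidableEq E]

/-- **The D-free inequality passes from the marked minors of the part to the parts of the marked
minors** (distinct marks in the minor). -/
theorem dFreeIneq_part_minor_of_minor_part (hg : G.IsGluing a b c side) (s : Bool)
    (u v : Config E) (hab : G.sureClass v a ≠ G.sureClass v b)
    (hac : G.sureClass v a ≠ G.sureClass v c) (hbc : G.sureClass v b ≠ G.sureClass v c)
    (h : ((G.part side s).minor (sideRestrict u side s) (sideRestrict v side s)).DFreeIneq
      ((G.part side s).sureClass (sideRestrict v side s) a)
      ((G.part side s).sureClass (sideRestrict v side s) b)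
      ((G.part side s).sureClass (sideRestrict v side s) c)) :
    ((G.minor u v).part (fun e => side e.1) s).DFreeIneq
      (G.sureClass v a) (G.sureClass v b) (G.sureClass v c) := by
  have hnd : ∀ m m', (m = a ∨ m = b ∨ m = c) → (m' = a ∨ m' = b ∨ m' = c) → m ≠ m' →
      ¬ G.Conn v m m' := by
    rintro m m' (rfl | rfl | rfl) (rfl | rfl | rfl) hne hmm
    · exact hne rfl
    · exact hab ((G.sureClass_eq_iff v _ _).mpr hmm)
    · exact hac ((G.sureClass_eq_iff v _ _).mpr hmm)
    · exact hab ((G.sureClass_eq_iff v _ _).mpr hmm).symm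
    · exact hne rfl
    · exact hbc ((G.sureClass_eq_iff v _ _).mpr hmm)
    · exact hac ((G.sureClass_eq_iff v _ _).mpr hmm).symm
    · exact hbc ((G.sureClass_eq_iff v _ _).mpr hmm).symm
    · exact hne rfl
  exact dFreeIneq_map (ε := faceEquiv side s u v) (φ := G.classMap side s v)
    (fun _ => rfl) (fun _ => rfl) (classMap_injOn hg s u v hnd) h

/-- **THE COMPOSITION THEOREM AT EVERY `p`** (mine-3 §26.8): for a 3-terminal gluing `G`, the D-free
inequality on every marked minor of each part (with the part's own sure classes as marks) gives
C-026 at every `p ∈ [0,1]^E` on `G`: `(x + y₁)(y₁ + z) ≤ y₁ + y₂ + y₃`. -/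
theorem c026_of_gluing_of_dFree_minors (G : MultiGraph V E) (a b c : V) (side : E → Bool)
    (hg : G.IsGluing a b c side)
    (h₁ : ∀ u₁ v₁ : Config {e // side e = true}, v₁ ≤ u₁ →
      ((G.part side true).minor u₁ v₁).DFreeIneq ((G.part side true).sureClass v₁ a)
        ((G.part side true).sureClass v₁ b) ((G.part side true).sureClass v₁ c))
    (h₀ : ∀ u₀ v₀ : Config {e // side e = false}, v₀ ≤ u₀ →
      ((G.part side false).minor u₀ v₀).DFreeIneq ((G.part side false).sureClass v₀ a)
        ((G.part side false).sureClass v₀ b) ((G.part side false).sureClass v₀ c))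
    (p : E → ℝ) (hp : IsProb p) :
    (G.law3 p a b c 0 + G.law3 p a b c 1) * (G.law3 p a b c 1 + G.law3 p a b c 4) ≤
      G.law3 p a b c 1 + G.law3 p a b c 2 + G.law3 p a b c 3 := by
  refine c026_of_gluing_minors G a b c side hg (fun u v huv hab hac hbc => ?_) p hp
  have huv₁ : sideRestrict v side true ≤ sideRestrict u side true := fun e => huv e.1
  have huv₀ : sideRestrict v side false ≤ sideRestrict u side false := fun e => huv e.1
  exact ⟨dFreeIneq_part_minor_of_minor_part hg true u v hab hac hbc (h₁ _ _ huv₁),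
    dFreeIneq_part_minor_of_minor_part hg false u v hab hac hbc (h₀ _ _ huv₀)⟩

end EveryP

end MultiGraph

end PercRepro
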